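import Literature.MathematicalPhysics.QuantumLattice.TorusSectorGibbsMixture
import Literature.MathematicalPhysics.QuantumLattice.HubbardWindowCertificate
import Literature.MathematicalPhysics.QuantumLattice.HubbardSquareTorusLimitState
import Literature.MathematicalPhysics.QuantumLattice.InfVolFermionStateDensity
import Literature.MathematicalPhysics.QuantumLattice.HubbardSpinChargeCertificate
import HarnessLib

/-!
# Charged-word (gauge) rows and spin-density rows of torus limits of fixed-sector mixtures, by name
# for the canonical sector Gibbs states of the `t–t'` torus

Topic `Literature/MathematicalPhysics/QuantumLattice`; companion of `TorusLimitOfMixtures.lean`,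
`HubbardOneBodyKinematicRows.lean` §5 and `TorusSectorGibbsMixture.lean` §4 (kinematic rows of mixture
torus limits by name). Two more state-independent constraint families of a window certificate hold for
every torus limit `ω` of translation-averaged MIXTURES `(p_{L,i}, ψ_{L,i})` whose components lie in joint
sectors `(N_L, S^z = M_L)` of the fermionic torus (`InfVolFermionState.IsTorusLimitOfMixture`):

* §1 **charged words are `ω`-null** (`U(1) × U(1)` gauge invariance of sector states): for every
  region `Λ` and every ladder word `W` with nonzero particle charge or nonzero spin charge,
  `ω_Λ(W) = 0` (`IsTorusLimitOfMixture.expect_ladderWord_eq_zero_of_szSector`; each translated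
  component `U_vψ_{L,i}` stays in the sector, and charged words have zero expectation in
  `N`-eigenvectors / `S^z`-eigenvectors, `star_dotProduct_ladderWord_mulVec_eq_zero(_of_spinCharge)`);
* §2 **spin densities of `S^z = 0` families**: `ω(n_{0↑}) = ω(n_{0↓}) = ρ_ω/2`
  (`IsTorusLimitOfMixture.expect_nAt_eq_half_density_of_szSector`; termwise
  `torusAvgExpect_nAt_of_mem_szSector` = half of `torusAvgExpect_nAt_add_nAt`), the mixture form of
  `IsTorusLimitOf.expect_nAt_eq_half_density_of_szSector`;
* §3 both BY NAME for the canonical Gibbs data `sectorGibbsWeightTT' β t t' U n`,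
  `sectorGibbsVectorTT' t t' U n` of `hubbardTorusTT' L t t' U` on `(rectN n L, S^z = 0)`
  (`…expect_ladderWord_eq_zero_of_sectorGibbs`, `…expect_nAt_eq_of_sectorGibbs`:
  `ω(n_{0σ}) = n/2`, and the window form `Re ω_{Λ'}(n_{0σ}) = n/2`, `…re_expect_nAt_eq_of_sectorGibbs`),
  i.e. the charged-word hypothesis and the density terms of the thermal window certificate
  (`HubbardTTPrimeThermalWindowCertificate.lean`) for thermal torus-limit states.

Everything is PROVED; no definition, no named fact; no temperature hypothesis.

## Mathlib / tree search

REUSED: `fermionEmbed_ladderWord`, `ladderCharge_map_embMap`, `ladderSpinCharge_map_embMap`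
(`HubbardWindowCertificate`), `star_dotProduct_ladderWord_mulVec_eq_zero` (`LadderWordCharge`),
`star_dotProduct_ladderWord_mulVec_eq_zero_of_spinCharge` (`HubbardSpinChargeCertificate`),
`fockTranslate_mulVec_mem_szSector`, `mem_szSector_iff`, `torusAvgExpectAt_of_injOn`,
`eventually_injOn_proj_of_tendsto`, `torusAvgExpect_nAt_of_mem_szSector` (`HubbardSquareTorusLimitState`),
`torusAvgExpect_nAt_add_nAt` (`InfVolFermionStateDensity`), `IsTorusLimitOfMixture.density_eq_of_sectorGibbs`,
`sectorGibbsVectorTT'_mem_szSector`, `star_sectorGibbsVectorTT'_dotProduct_self` (`TorusSectorGibbsMixture`).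
`lean search 'IsTorusLimitOfMixture.*ladderWord|IsTorusLimitOfMixture.*nAt'`: nothing (2026-08-26); the
pure-state versions are `IsTorusLimitOf.expect_nAt_eq_half_density_of_szSector` and the finite-torus
charged-word bookkeeping inside `re_expect_ge_of_window_certificate_ineq`.

## References

* X. Han, *Quantum many-body bootstrap*, arXiv:2006.06002 (2020), §2–§3 (charge / `S^z` selection
  rules as constraints). [cite: Han2020Bootstrap, §3]
* E. H. Lieb, Phys. Rev. Lett. 62 (1989) 1201, eq. (2) (`S^z = 0`: `N↑ = N↓ = N/2`). [cite: LiebPRL1989, eq. (2)]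
* D. Ruelle, *Statistical Mechanics: Rigorous Results* (1969), §3.4. [cite: Ruelle1969, §3.4]
-/

noncomputable section

namespace Literature.MathematicalPhysics.QuantumLattice

open Matrix Finset HubbardWave0 Literature.Probability.LatticeModels ThermodynamicLimit
open _root_.Filter
open scoped _root_.Topology ComplexOrder BigOperators

/-! ### §1 Charged words are null in torus limits of fixed-sector mixtures -/

section Torus

variable {d : ℕ} (L : ℕ) [NeZero L]

/-- **A charged word has zero translation-averaged expectation in a sector vector**: for
`ψ ∈ (N, S^z = M)` and a ladder word `W ∈ 𝔄_Λ` with `q(W) ≠ 0` or `q_s(W) ≠ 0`,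
`torusAvgExpectAt L Λ W ψ = 0` (every translate `U_vψ` lies in the sector; the embedded word is a
ladder word of the torus with the same charges). [cite: Han2020Bootstrap, §3] -/
theorem torusAvgExpectAt_ladderWord_eq_zero_of_mem_szSector {Λ : Finset (Site d)} {N : ℕ} {M : ℝ}
    {ψ : Fock (Orb (FermionTorus d L))} (hψ : ψ ∈ szSector N M)
    (l : List (Orb (PolySite Λ) × Bool)) (hl : ladderCharge l ≠ 0 ∨ ladderSpinCharge l ≠ 0) :
    torusAvgExpectAt L Λ (ladderWord l) ψ = 0 := by
  by_cases hInj : Set.InjOn (Torus.proj (d := d) L) ↑Λ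
  · rw [torusAvgExpectAt_of_injOn L hInj, fermionEmbed_ladderWord, Finset.sum_eq_zero fun v _ => ?_, mul_zero]
    obtain ⟨hN, hS⟩ := (mem_szSector_iff N M _).1 (fockTranslate_mulVec_mem_szSector v hψ)
    rw [expect]
    rcases hl with hq | hs
    · exact star_dotProduct_ladderWord_mulVec_eq_zero hN _ (by rwa [ladderCharge_map_embMap])
    · exact star_dotProduct_ladderWord_mulVec_eq_zero_of_spinCharge hS _ (by rwa [ladderSpinCharge_map_embMap])
  · exact torusAvgExpectAt_of_not_injOn L hInj _ _

end Torus

namespace InfVolFermionState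

variable {d : ℕ}

/-- **Charged words are null in every torus limit of fixed-sector mixtures** (`U(1) × U(1)` gauge
invariance): if the components `ψ_{L,i}` lie in joint sectors `(N_L, S^z = M_L)`, then for every region
`Λ` and every ladder word `W ∈ 𝔄_Λ` with nonzero particle or spin charge, `ω_Λ(W) = 0`. No hypothesis
on the weights. [cite: Han2020Bootstrap, §3] -/
theorem IsTorusLimitOfMixture.expect_ladderWord_eq_zero_of_szSector {ω : InfVolFermionState d} {m : ℕ → ℕ}
    {p : ∀ L, Fin (m L) → ℝ} {ψ : ∀ L, Fin (m L) → Fock (Orb (FermionTorus d L))} {Ls : ℕ → ℕ}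
    (h : ω.IsTorusLimitOfMixture m p ψ Ls) (hLs : Tendsto Ls atTop atTop) {N : ℕ → ℕ} {M : ℕ → ℝ}
    (hψ : ∀ L i, ψ L i ∈ szSector (N L) (M L)) {Λ : Finset (Site d)}
    (l : List (Orb (PolySite Λ) × Bool)) (hl : ladderCharge l ≠ 0 ∨ ladderSpinCharge l ≠ 0) :
    ω.expect Λ (ladderWord l) = 0 := by
  refine tendsto_nhds_unique (h Λ _) (tendsto_const_nhds.congr' ?_)
  filter_upwards [hLs.eventually_ge_atTop 1] with j hj
  haveI : NeZero (Ls j) := ⟨by omega⟩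
  refine (Finset.sum_eq_zero fun i _ => ?_).symm
  rw [torusAvgExpect_eq, torusAvgExpectAt_ladderWord_eq_zero_of_mem_szSector (Ls j) (hψ _ i) l hl, mul_zero]

/-! ### §2 Spin densities of torus limits of `S^z = 0` mixtures -/

/-- **Spin densities of a torus limit of `S^z = 0` mixtures are half the particle density**: if the
components are unit vectors of the sectors `(N_L, S^z = 0)`, then `ω(n_{0σ}) = ρ_ω/2` for both spins
(termwise, the translation average of `n_{0σ}` in `ψ_{L,i}` is `(N_L/2)/L^d`, half of that of
`n_{0↑} + n_{0↓}`; no hypothesis on the weights or on `N_L/L^d`). [cite: LiebPRL1989, eq. (2)] -/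
theorem IsTorusLimitOfMixture.expect_nAt_eq_half_density_of_szSector {ω : InfVolFermionState d} {m : ℕ → ℕ}
    {p : ∀ L, Fin (m L) → ℝ} {ψ : ∀ L, Fin (m L) → Fock (Orb (FermionTorus d L))} {Ls : ℕ → ℕ}
    (h : ω.IsTorusLimitOfMixture m p ψ Ls) (hLs : Tendsto Ls atTop atTop) {N : ℕ → ℕ}
    (hS : ∀ L i, ψ L i ∈ szSector (N L) 0) (h1 : ∀ L i, star (ψ L i) ⬝ᵥ ψ L i = 1) (σ : Fin 2) :
    ω.expect {0} (nAt 0 (Finset.mem_singleton_self 0) σ) = (((ω.density / 2 : ℝ)) : ℂ) := by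
  have hN : ∀ L i, IsNParticle (N L) (ψ L i) := fun L i => ((mem_szSector_iff _ _ _).1 (hS L i)).1
  -- the weighted torus averages of `n_{0↑} + n_{0↓}` converge to `ρ_ω`
  have hdens := h ({0} : Finset (Site d))
    (nAt 0 (Finset.mem_singleton_self 0) 0 + nAt 0 (Finset.mem_singleton_self 0) 1)
  have hval : ω.expect {0} (nAt 0 (Finset.mem_singleton_self 0) 0 + nAt 0 (Finset.mem_singleton_self 0) 1) =
      ((ω.density : ℝ) : ℂ) := by
    have him : (ω.expect {0} (nAt 0 (Finset.mem_singleton_self 0) 0 +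
        nAt 0 (Finset.mem_singleton_self 0) 1)).im = 0 := by
      refine ω.expect_im_eq_zero_of_isHermitian ?_
      rw [nAt, nAt, ← numberAt_orb, ← numberAt_orb]
      exact (numberAt_isHermitian _).add (numberAt_isHermitian _)
    exact Complex.ext (by rw [InfVolFermionState.density, InfVolFermionState.densityAt, Complex.ofReal_re])
      (by rw [him, Complex.ofReal_im])
  rw [hval] at hdens
  -- the spin-`σ` averages are exactly half of them, termwise
  have hlim := h ({0} : Finset (Site d)) (nAt 0 (Finset.mem_singleton_self 0) σ)
  have heq : ∀ᶠ j in atTop, ∑ i, (p (Ls j) i : ℂ) * torusAvgExpect (Ls j) ({0} : Finset (Site d))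
      (nAt 0 (Finset.mem_singleton_self 0) σ) (ψ (Ls j) i) =
        (1 / 2 : ℂ) * ∑ i, (p (Ls j) i : ℂ) * torusAvgExpect (Ls j) ({0} : Finset (Site d))
          (nAt 0 (Finset.mem_singleton_self 0) 0 + nAt 0 (Finset.mem_singleton_self 0) 1) (ψ (Ls j) i) := by
    filter_upwards [hLs.eventually_ge_atTop 1] with j hj
    haveI : NeZero (Ls j) := ⟨Nat.one_le_iff_ne_zero.1 hj⟩
    rw [Finset.mul_sum]
    refine Finset.sum_congr rfl fun i _ => ?_
    rw [torusAvgExpect_nAt_of_mem_szSector (Ls j) σ (hS _ i) (h1 _ i),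
      torusAvgExpect_nAt_add_nAt (Ls j) (hN _ i) (h1 _ i)]
    push_cast
    ring
  have hhalf := hdens.const_mul (1 / 2 : ℂ)
  have hv := tendsto_nhds_unique hlim (hhalf.congr' (heq.mono fun j hj => hj.symm))
  rw [hv]
  push_cast
  ring

/-! ### §3 By name for the canonical sector Gibbs states of the `t–t'` torus -/

/-- **Charged words are null in thermal torus limits**: for every torus limit `ω` of the canonical
Gibbs states of `hubbardTorusTT' (Ls j) t t' U` on the sectors `(rectN n (Ls j), S^z = 0)` (any
`β, t, t', U, n`, `Ls → ∞`), every region `Λ` and every ladder word `W ∈ 𝔄_Λ` with nonzero particle or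
spin charge: `ω_Λ(W) = 0` — the charged-word hypothesis of the thermal window certificate.
[cite: Han2020Bootstrap, §3] -/
theorem IsTorusLimitOfMixture.expect_ladderWord_eq_zero_of_sectorGibbs (t t' U n β : ℝ)
    {ω : InfVolFermionState 2} {Ls : ℕ → ℕ}
    (h : ω.IsTorusLimitOfMixture (sectorGibbsCount n) (fun L => sectorGibbsWeightTT' β t t' U n L)
      (fun L => sectorGibbsVectorTT' t t' U n L) Ls)
    (hLs : Tendsto Ls atTop atTop) {Λ : Finset (Site 2)}
    (l : List (Orb (PolySite Λ) × Bool)) (hl : ladderCharge l ≠ 0 ∨ ladderSpinCharge l ≠ 0) :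
    ω.expect Λ (ladderWord l) = 0 :=
  h.expect_ladderWord_eq_zero_of_szSector hLs (N := fun L => rectN n L) (M := fun _ => 0)
    (fun L i => sectorGibbsVectorTT'_mem_szSector t t' U n L i) l hl

/-- **Spin densities of thermal torus limits**: `ω(n_{0σ}) = n/2` for every torus limit of the
canonical sector Gibbs states on `(rectN n (Ls j), S^z = 0)` (`0 ≤ n ≤ 2`, any `β`).
[cite: LiebPRL1989, eq. (2)] -/
theorem IsTorusLimitOfMixture.expect_nAt_eq_of_sectorGibbs (t t' U : ℝ) {n : ℝ} (hn0 : 0 ≤ n)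
    (hn2 : n ≤ 2) (β : ℝ) {ω : InfVolFermionState 2} {Ls : ℕ → ℕ}
    (h : ω.IsTorusLimitOfMixture (sectorGibbsCount n) (fun L => sectorGibbsWeightTT' β t t' U n L)
      (fun L => sectorGibbsVectorTT' t t' U n L) Ls)
    (hLs : Tendsto Ls atTop atTop) (σ : Fin 2) :
    ω.expect {0} (nAt 0 (Finset.mem_singleton_self 0) σ) = (((n / 2 : ℝ)) : ℂ) := by
  rw [h.expect_nAt_eq_half_density_of_szSector hLs (N := fun L => rectN n L)
    (fun L i => sectorGibbsVectorTT'_mem_szSector t t' U n L i)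
    (fun L i => star_sectorGibbsVectorTT'_dotProduct_self t t' U n L i) σ,
    h.density_eq_of_sectorGibbs t t' U hn0 hn2 β hLs]

/-- The same in a window `Λ' ∋ 0`: `Re ω_{Λ'}(n_{0σ}) = n/2` (compatibility with `{0} ⊆ Λ'`) — the
value of the density terms `μ_σ (Re ω_{Λ'}(n_{0σ}) − ν)` of a window certificate in a thermal torus
limit. [cite: LiebPRL1989, eq. (2)] -/
theorem IsTorusLimitOfMixture.re_expect_nAt_eq_of_sectorGibbs (t t' U : ℝ) {n : ℝ} (hn0 : 0 ≤ n)
    (hn2 : n ≤ 2) (β : ℝ) {ω : InfVolFermionState 2} {Ls : ℕ → ℕ}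
    (h : ω.IsTorusLimitOfMixture (sectorGibbsCount n) (fun L => sectorGibbsWeightTT' β t t' U n L)
      (fun L => sectorGibbsVectorTT' t t' U n L) Ls)
    (hLs : Tendsto Ls atTop atTop) {Λ' : Finset (Site 2)} (hz : (0 : Site 2) ∈ Λ') (σ : Fin 2) :
    (ω.expect Λ' (nAt 0 hz σ)).re = n / 2 := by
  have hemb : fermionEmbed (PolySite.incl (Finset.singleton_subset_iff.2 hz))
      (nAt 0 (Finset.mem_singleton_self (0 : Site 2)) σ) = (nAt 0 hz σ : FermionOp Λ') :=
    fermionEmbed_numberOp _ _ _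
  rw [← hemb, ω.compatible, h.expect_nAt_eq_of_sectorGibbs t t' U hn0 hn2 β hLs σ, Complex.ofReal_re]

end InfVolFermionState

end Literature.MathematicalPhysics.QuantumLattice

end
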